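import Summits.Ventures.HSemireg.Pad4FirstOrderModelFlagRows

/-!
# Venture HSemireg — THEOREM L^ζ step S4a: THE UPPER ROWS OF A COPY OF `Q₀` AT `κ₁ = E_{τf}`, TERM BY TERM (the
# participants of THE END; companion of `Pad4FirstOrderModel.lean`, row 716; TIER-2 step S4, first file)

HONEST FRAMING. PROVED statements about the first-order MODEL of the PAD-4 anchor (seat s4-prove-1 g24, TRACK S4-PUSH lane
(ii), 2026-08-27). `TheoremLZetaMain` ∕ `TheoremLZeta` (p505821) stay kernel-OPEN (`@[conjecture]`); nothing here proves them.
WHAT IS PROVED. For a top flag `X = a ℓ^{(σ)} + h ℓ_ζ^{(f)}` (S2c), a copy `Q₀^{j₀}` of `Q₀ = h ℓ_ζ^{(f)}`, a third axis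
`τ ∉ {σ, f}` and unknowns `η'_r ∈ H²(Q₀ − N_r)` of the `E₊`-side system of the row object `j₀` (`UpperRowSolvable`), the
`r`-th term of the row `s` read on the Künneth block `(f:1, τ:1)` of `H²(Q₀ − P_s)` is computed for every participant:
an f-SERVER `S = N_r` against a copy `Q₀^s` (`upper_term_server_Q0`: evaluation `R_k^* × R_k → Ξ_ζ` on `f` read at
`ē_{A,f}`, identity on `V_τ`) and against a companion `C` below it (`upper_term_server_comp`: the transposed ring product
`R_k^* × R_{s−c} → R_{c−h}^*`); a τ-FLAG `X' = N_r` against a copy `Q₀^s` (`upper_term_flag_Q0`: evaluation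
`R_{a'}^* × R_{a'} → Ξ_{ζ'}^{(τ)}`, identity on `V_f`); and the vanishing of every other term (`upper_term_server_comp_zero`,
`upper_term_flag_comp_zero`, `upper_term_other_zero`: no section, no `(f:1, τ:1)` block — σ- and fourth-axis flags, other
layers —, or `Minimal`), using (F1) `hmax` ∕ (F2)'s classification of the `N ≥ Q₀`. Also: the rows `s ∈` copies ∕
companions are KEPT (`UpperRowPure`, `upperRowPure_Q0 ∕ _comp`) and the coordinates used lie in `idxH2` (`mem_idxH2_Q0_Q0`,
`mem_idxH2_Q0_comp`). THE END itself (the combination and `TheoremLZetaMain`) is NOT in this file. No variety, sheaf or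
semiregularity map is constructed; nothing here says HC ∕ HC_CM ∕ HC_AV holds; no fact, no definition, no instance, no
notation. REUSE: rows 716, 731, 739, S2a, S2c, S3a, S3. FRAMING OF RECORD (director-hodge g10, cell INBOX l.31483 (a)): everything in this file is a theorem of the finite-dimensional
FIRST-ORDER MODEL of row 716 (`Pad4FirstOrderModel.lean`) and of nothing else; the model-to-sheaf bridge (Buchweitz–Flenner 2003)
is NOT in the tree; the cell's (S3) ∕ (S5) STATUS WORDS do not move; no object is certified; nothing here bears on HC ∕ HC_CM ∕
HC_AV ∕ W₆ or on `stub_rung_pad4_seedAt`.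
Typed ≠ proved ≠ endorsed.
-/

noncomputable section
namespace Summit.Ventures.HSemireg.Pad4FirstOrder
open Finset

section EndTerms
variable {D : Design} {φ : D.Sections} (T : TopFlag D φ)

/-! ## Kept rows and coordinates -/

/-- two copies of `Q₀` have the same class: `rel = zero` on every factor. -/
theorem TopFlag.rel_Q0_Q0 {j₀ s : Fin D.nP} (hj₀ : T.IsQ0 j₀) (hs : T.IsQ0 s) (g : Fin 4) :
    rel (D.P j₀) (D.P s) g = Rel.zero := by
  obtain ⟨hl, hf, hph, h0⟩ := topFlag_Q0 D φ T j₀ hj₀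
  obtain ⟨hl', hf', hph', h0'⟩ := topFlag_Q0 D φ T s hs
  by_cases hg : g = T.f
  · rw [hg]; exact rel_zero_of_eq _ _ _ (hl.trans hl'.symm) (hf.trans hf'.symm) (Or.inr (hph.trans hph'.symm))
  · exact rel_zero_of_eq _ _ _ (hl.trans hl'.symm) (by rw [h0 g hg, h0' g hg]) (Or.inl (h0' g hg))

/-- a copy of `Q₀` against a companion `C`: `Q₀ − C = −(c − h) ℓ_ζ^{(f)}`, class `0` off `f`. -/
theorem TopFlag.rel_Q0_comp {j₀ s : Fin D.nP} (hj₀ : T.IsQ0 j₀) (hs : T.IsComp s) :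
    rel (D.P j₀) (D.P s) T.f = Rel.neg ((D.P s).charge T.f - (D.N T.i).charge T.f) ((D.N T.i).phase T.f) ∧
    ∀ g, g ≠ T.f → rel (D.P j₀) (D.P s) g = Rel.zero := by
  obtain ⟨hl, hf, hph, h0⟩ := topFlag_Q0 D φ T j₀ hj₀
  obtain ⟨hCl, hCph, hClt, hC0⟩ := hs
  refine ⟨?_, fun g hg => rel_zero_of_eq _ _ _ (hl.trans hCl.symm) (by rw [h0 g hg, hC0 g hg]) (Or.inl (hC0 g hg))⟩
  rw [rel_of_lt _ _ T.f (hl.trans hCl.symm) (by rw [hf]; exact hClt) (Or.inr (hCph.trans hph.symm)), hf, hCph]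

/-- an `N r` with a section to a copy of `Q₀` or to a companion lies in the flag's layer and carries the phase `ζ` on `f`. -/
theorem TopFlag.layer_phase_of_section {r : Fin D.nN} {s : Fin D.nP} (hs : T.IsQ0 s ∨ T.IsComp s)
    (hne : (idxH0 (D.N r) (D.P s)).Nonempty) :
    (D.N r).layer = (D.N T.i).layer ∧ (D.N r).phase T.f = (D.N T.i).phase T.f ∧
      (D.N T.i).charge T.f ≤ (D.N r).charge T.f := by
  obtain ⟨hl, hP0⟩ := (idxH0_nonempty_iff _ _).1 hne
  have hsf : (D.P s).layer = (D.N T.i).layer ∧ (D.P s).phase T.f = (D.N T.i).phase T.f ∧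
      (D.N T.i).charge T.f ≤ (D.P s).charge T.f := by
    rcases hs with hs | hs
    · obtain ⟨hl', hf', hph', -⟩ := topFlag_Q0 D φ T s hs; exact ⟨hl', hph', hf'.ge⟩
    · exact ⟨hs.1, hs.2.1, hs.2.2.1.le⟩
  rcases hP0 T.f with h0 | ⟨hp, hle⟩
  · exfalso; have := T.flag_f; omega
  · exact ⟨hl.trans hsf.1, hp.trans hsf.2.1, hsf.2.2.trans hle⟩

/-- the rows `s =` a copy of `Q₀` or a companion of the row object `j₀` (a copy of `Q₀`) are KEPT: every participant
`N r ≥ P s` carries the phase `ζ` on `f`, the only charged factor of `Q₀`. -/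
theorem TopFlag.upperRowPure_of {j₀ s : Fin D.nP} (hj₀ : T.IsQ0 j₀) (hs : T.IsQ0 s ∨ T.IsComp s) :
    D.UpperRowPure j₀ s := by
  intro r hne g
  obtain ⟨hl, hph, -⟩ := T.layer_phase_of_section hs hne
  obtain ⟨hQl, -, hQph, hQ0⟩ := topFlag_Q0 D φ T j₀ hj₀
  rw [rel_ne_dead_iff]
  refine ⟨hQl.trans hl.symm, ?_⟩
  by_cases hg : g = T.f
  · rw [hg]; exact Or.inr (Or.inr (hQph.trans hph.symm))
  · exact Or.inl (hQ0 g hg)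

/-- the coordinate `(qPair f τ, [τ ↦ y])`, `y ∈ {ē_A, ē_B}`, of `H²(Q₀ − Q₀) = H²(O)`. -/
theorem TopFlag.mem_idxH2_Q0_Q0 {τ : Fin 4} (hτf : τ ≠ T.f) {j₀ s : Fin D.nP} (hj₀ : T.IsQ0 j₀) (hs : T.IsQ0 s)
    (y : ℕ × ℕ) (hy : y = (0, 0) ∨ y = (1, 0)) :
    (qPair T.f τ, Function.update (fun _ => ((0 : ℕ), (0 : ℕ))) τ y) ∈ idxH2 (D.P j₀) (D.P s) := by
  refine (mem_idxH2_iff _ _ _).2 ⟨qPair_mem_qDist2 _ _ hτf.symm, fun g => ?_⟩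
  dsimp only
  rw [T.rel_Q0_Q0 hj₀ hs g]
  by_cases hgτ : g = τ
  · subst hgτ; rw [Function.update_self, qPair_right, idx_zero_one]; rcases hy with rfl | rfl <;> simp
  by_cases hgf : g = T.f
  · subst hgf; rw [Function.update_of_ne hgτ, qPair_left, idx_zero_one]; simp
  · rw [Function.update_of_ne hgτ, qPair_of_ne hgf hgτ, idx_zero_zero]; exact mem_singleton_self _

/-- the coordinate `(qPair f τ, [f ↦ o', τ ↦ y])`, `o' ∈ R_{c−h}`, of `H²(Q₀ − C) = H²(−(c−h) ℓ_ζ^{(f)})`. -/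
theorem TopFlag.mem_idxH2_Q0_comp {τ : Fin 4} (hτf : τ ≠ T.f) {j₀ s : Fin D.nP} (hj₀ : T.IsQ0 j₀) (hs : T.IsComp s)
    {o' : ℕ × ℕ} (ho' : o' ∈ monIdx ((D.P s).charge T.f - (D.N T.i).charge T.f)) (y : ℕ × ℕ)
    (hy : y = (0, 0) ∨ y = (1, 0)) :
    (qPair T.f τ, Function.update (Function.update (fun _ => ((0 : ℕ), (0 : ℕ))) T.f o') τ y) ∈
      idxH2 (D.P j₀) (D.P s) := by
  obtain ⟨hf, h0⟩ := T.rel_Q0_comp hj₀ hs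
  refine (mem_idxH2_iff _ _ _).2 ⟨qPair_mem_qDist2 _ _ hτf.symm, fun g => ?_⟩
  dsimp only
  by_cases hgτ : g = τ
  · subst hgτ; rw [Function.update_self, h0 _ hτf, qPair_right, idx_zero_one]; rcases hy with rfl | rfl <;> simp
  by_cases hgf : g = T.f
  · subst hgf; rw [Function.update_of_ne hgτ, Function.update_self, hf, qPair_left, idx_neg_one]; exact ho'
  · rw [update_update_apply_of_ne hgf hgτ, h0 g hgf, qPair_of_ne hgf hgτ, idx_zero_zero]; exact mem_singleton_self _

/-! ## The terms of an f-server -/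

/-- a copy of `Q₀` against a server: `Q₀ − S = −(s − h) ℓ_ζ^{(f)}`, class `0` off `f`. -/
theorem TopFlag.rel_Q0_server {j₀ : Fin D.nP} (hj₀ : T.IsQ0 j₀) {r : Fin D.nN} (hr : T.IsServer r) :
    rel (D.P j₀) (D.N r) T.f = Rel.neg ((D.N r).charge T.f - (D.N T.i).charge T.f) ((D.N T.i).phase T.f) ∧
    ∀ g, g ≠ T.f → rel (D.P j₀) (D.N r) g = Rel.zero := by
  obtain ⟨hl, hf, hph, h0⟩ := topFlag_Q0 D φ T j₀ hj₀
  obtain ⟨hSl, hSph, hSlt, hS0⟩ := hr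
  refine ⟨?_, fun g hg => rel_zero_of_eq _ _ _ (hl.trans hSl.symm) (by rw [h0 g hg, hS0 g hg]) (Or.inl (hS0 g hg))⟩
  rw [rel_of_lt _ _ T.f (hl.trans hSl.symm) (by rw [hf]; exact hSlt) (Or.inr (hSph.trans hph.symm)), hf, hSph]

/-- THE END, an f-server against a copy `Q₀^s`: its term of the row `s` at `(qPair f τ, [τ ↦ y])` is
`Σ_{ι ∈ R_k} φ_{S s}(ι) · η'_S(qPair f τ, [f ↦ ι, τ ↦ y])` (evaluation on `f` read at `ē_{A,f}`, identity on `V_τ`). -/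
theorem upper_term_server_Q0 (η' : Fin D.nN → (Fin 4 → ℕ) → (Fin 4 → ℕ × ℕ) → ℂ) {τ : Fin 4} (hτf : τ ≠ T.f)
    {j₀ : Fin D.nP} (hj₀ : T.IsQ0 j₀) {r : Fin D.nN} (hr : T.IsServer r) {s : Fin D.nP} (hs : T.IsQ0 s) (y : ℕ × ℕ)
    (hy : y = (0, 0) ∨ y = (1, 0)) :
    ∑ u ∈ idxH2 (D.P j₀) (D.N r), ∑ a ∈ idxH0 (D.N r) (D.P s),
        (if u.1 = qPair T.f τ then coefProd (rel (D.P j₀) (D.N r)) (rel (D.N r) (D.P s)) (qPair T.f τ) u.2 a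
          (Function.update (fun _ => ((0 : ℕ), (0 : ℕ))) τ y) else 0) * φ r s a * η' r u.1 u.2 =
      ∑ ι ∈ monIdx ((D.N r).charge T.f - (D.N T.i).charge T.f),
        φ r s (Function.update (fun _ => ((0 : ℕ), (0 : ℕ))) T.f ι) *
          η' r (qPair T.f τ) (Function.update (Function.update (fun _ => ((0 : ℕ), (0 : ℕ))) T.f ι) τ y) := by
  obtain ⟨hfU, hU0⟩ := T.rel_Q0_server hj₀ hr
  obtain ⟨hfS, hS0⟩ := T.isServer_rel_Q0 hr hs
  rw [term_restrict _ _ _ _ _ (qPair_mem_qDist2 _ _ hτf.symm),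
    sum_piFinset_pair _ T.f τ hτf.symm (fun g hgf hgτ => by rw [hU0 g hgf, qPair_of_ne hgf hgτ, idx_zero_zero]),
    hfU, qPair_left, idx_neg_one, hU0 τ hτf, qPair_right, idx_zero_one]
  refine Finset.sum_congr rfl fun ι hι => ?_
  have hc : ∀ y' z : ℕ × ℕ, coefProd (rel (D.P j₀) (D.N r)) (rel (D.N r) (D.P s)) (qPair T.f τ)
      (Function.update (Function.update (fun _ => ((0 : ℕ), (0 : ℕ))) T.f ι) τ y')
      (Function.update (fun _ => ((0 : ℕ), (0 : ℕ))) T.f z) (Function.update (fun _ => ((0 : ℕ), (0 : ℕ))) τ y) =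
      (if z = ι then 1 else 0) * (if y = y' then 1 else 0) := by
    intro y' z
    rw [coefProd_split2 _ _ _ _ _ _ T.f τ hτf.symm (fun g hgf hgτ => by
      rw [hS0 g hgf, coef_zero_right, update_update_apply_of_ne hgf hgτ, Function.update_of_ne hgτ, if_pos rfl]),
      hfU, hfS, hU0 τ hτf, hS0 τ hτf, qPair_left, qPair_right]
    simp only [Function.update_self, Function.update_of_ne hτf.symm, Function.update_of_ne hτf,
      coef_neg_one_pos_self, coef_zero_right, xiBar_A]
  have inner : ∀ y' : ℕ × ℕ, ∑ a ∈ idxH0 (D.N r) (D.P s), coefProd (rel (D.P j₀) (D.N r)) (rel (D.N r) (D.P s))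
      (qPair T.f τ) (Function.update (Function.update (fun _ => ((0 : ℕ), (0 : ℕ))) T.f ι) τ y') a
      (Function.update (fun _ => ((0 : ℕ), (0 : ℕ))) τ y) * φ r s a =
      if y = y' then φ r s (Function.update (fun _ => ((0 : ℕ), (0 : ℕ))) T.f ι) else 0 := by
    intro y'
    unfold idxH0
    rw [sum_piFinset_single _ T.f (fun g hg => by rw [hS0 g hg, idx_zero_zero]), hfS, idx_pos_zero,
      Finset.sum_congr rfl (fun z _ => by rw [hc y' z]),
      Finset.sum_eq_single_of_mem ι hι (fun z _ hz => by rw [if_neg hz]; ring), if_pos rfl, one_mul]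
    split_ifs <;> ring
  simp_rw [inner, ite_mul, zero_mul]
  rw [Finset.sum_ite_eq]
  rcases hy with rfl | rfl <;> simp

/-- THE END, an f-server against a companion `C` below it: its term of the row `C` at `(qPair f τ, [f ↦ o', τ ↦ y])` is
`Σ_{ι ∈ R_k} (Σ_{a' ∈ R_{s−c}} mulCoef(a', o', ι) φ_{S C}(a')) · η'_S(qPair f τ, [f ↦ ι, τ ↦ y])` (transposed ring product). -/
theorem upper_term_server_comp (η' : Fin D.nN → (Fin 4 → ℕ) → (Fin 4 → ℕ × ℕ) → ℂ) {τ : Fin 4} (hτf : τ ≠ T.f)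
    {j₀ : Fin D.nP} (hj₀ : T.IsQ0 j₀) {r : Fin D.nN} (hr : T.IsServer r) {s : Fin D.nP} (hs : T.IsComp s)
    (hlt : (D.P s).charge T.f < (D.N r).charge T.f) (o' : ℕ × ℕ) (y : ℕ × ℕ) (hy : y = (0, 0) ∨ y = (1, 0)) :
    ∑ u ∈ idxH2 (D.P j₀) (D.N r), ∑ a ∈ idxH0 (D.N r) (D.P s),
        (if u.1 = qPair T.f τ then coefProd (rel (D.P j₀) (D.N r)) (rel (D.N r) (D.P s)) (qPair T.f τ) u.2 a
          (Function.update (Function.update (fun _ => ((0 : ℕ), (0 : ℕ))) T.f o') τ y) else 0) * φ r s a * η' r u.1 u.2 =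
      ∑ ι ∈ monIdx ((D.N r).charge T.f - (D.N T.i).charge T.f),
        (∑ a' ∈ monIdx ((D.N r).charge T.f - (D.P s).charge T.f),
          (mulCoef a' o' ι : ℂ) * φ r s (Function.update (fun _ => ((0 : ℕ), (0 : ℕ))) T.f a')) *
          η' r (qPair T.f τ) (Function.update (Function.update (fun _ => ((0 : ℕ), (0 : ℕ))) T.f ι) τ y) := by
  obtain ⟨hfU, hU0⟩ := T.rel_Q0_server hj₀ hr
  obtain ⟨hfS, hS0, -, -, -⟩ := T.isServer_rel_comp hr hs hlt
  have hch : (D.N T.i).charge T.f < (D.P s).charge T.f := hs.2.2.1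
  rw [term_restrict _ _ _ _ _ (qPair_mem_qDist2 _ _ hτf.symm),
    sum_piFinset_pair _ T.f τ hτf.symm (fun g hgf hgτ => by rw [hU0 g hgf, qPair_of_ne hgf hgτ, idx_zero_zero]),
    hfU, qPair_left, idx_neg_one, hU0 τ hτf, qPair_right, idx_zero_one]
  refine Finset.sum_congr rfl fun ι _ => ?_
  have hc : ∀ y' z : ℕ × ℕ, coefProd (rel (D.P j₀) (D.N r)) (rel (D.N r) (D.P s)) (qPair T.f τ)
      (Function.update (Function.update (fun _ => ((0 : ℕ), (0 : ℕ))) T.f ι) τ y')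
      (Function.update (fun _ => ((0 : ℕ), (0 : ℕ))) T.f z)
      (Function.update (Function.update (fun _ => ((0 : ℕ), (0 : ℕ))) T.f o') τ y) =
      (mulCoef z o' ι : ℂ) * (if y = y' then 1 else 0) := by
    intro y' z
    rw [coefProd_split2 _ _ _ _ _ _ T.f τ hτf.symm (fun g hgf hgτ => by
      rw [hS0 g hgf, coef_zero_right, update_update_apply_of_ne hgf hgτ, update_update_apply_of_ne hgf hgτ,
        if_pos rfl]), hfU, hfS, hU0 τ hτf, hS0 τ hτf, qPair_left, qPair_right]
    simp only [Function.update_self, Function.update_of_ne hτf.symm, Function.update_of_ne hτf, coef_zero_right]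
    rw [coef_neg_pos_lt _ _ _ _ _ _ _ (by omega)]
  have inner : ∀ y' : ℕ × ℕ, ∑ a ∈ idxH0 (D.N r) (D.P s), coefProd (rel (D.P j₀) (D.N r)) (rel (D.N r) (D.P s))
      (qPair T.f τ) (Function.update (Function.update (fun _ => ((0 : ℕ), (0 : ℕ))) T.f ι) τ y') a
      (Function.update (Function.update (fun _ => ((0 : ℕ), (0 : ℕ))) T.f o') τ y) * φ r s a =
      if y = y' then ∑ a' ∈ monIdx ((D.N r).charge T.f - (D.P s).charge T.f),
        (mulCoef a' o' ι : ℂ) * φ r s (Function.update (fun _ => ((0 : ℕ), (0 : ℕ))) T.f a') else 0 := by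
    intro y'
    unfold idxH0
    rw [sum_piFinset_single _ T.f (fun g hg => by rw [hS0 g hg, idx_zero_zero]), hfS, idx_pos_zero,
      Finset.sum_congr rfl (fun z _ => by rw [hc y' z])]
    split_ifs with h
    · exact Finset.sum_congr rfl fun z _ => by ring
    · simp
  simp_rw [inner, ite_mul, zero_mul]
  rw [Finset.sum_ite_eq]
  rcases hy with rfl | rfl <;> simp

/-- THE END, an f-server against a companion NOT below it: no term (`c > s`: no section; `c = s`: `S`'s class, `Minimal`). -/
theorem upper_term_server_comp_zero (hmin : D.Minimal φ) (η' : Fin D.nN → (Fin 4 → ℕ) → (Fin 4 → ℕ × ℕ) → ℂ)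
    {j₀ : Fin D.nP} {r : Fin D.nN} (hr : T.IsServer r) {s : Fin D.nP} (hs : T.IsComp s)
    (hge : ¬ (D.P s).charge T.f < (D.N r).charge T.f) (q : Fin 4 → ℕ) (O : Fin 4 → ℕ × ℕ) :
    ∑ u ∈ idxH2 (D.P j₀) (D.N r), ∑ a ∈ idxH0 (D.N r) (D.P s),
        (if u.1 = q then coefProd (rel (D.P j₀) (D.N r)) (rel (D.N r) (D.P s)) q u.2 a O else 0) * φ r s a *
          η' r u.1 u.2 = 0 := by
  obtain ⟨hSl, hSph, hSlt, hS0⟩ := hr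
  obtain ⟨hCl, hCph, hClt, hC0⟩ := hs
  refine Finset.sum_eq_zero fun u _ => Finset.sum_eq_zero fun a ha => ?_
  obtain ⟨hl, hP0⟩ := (idxH0_nonempty_iff _ _).1 ⟨a, ha⟩
  rcases hP0 T.f with h0 | ⟨hp, hle⟩
  · exfalso; omega
  have hcs : (D.P s).charge T.f = (D.N r).charge T.f := by omega
  have hall : ∀ g, rel (D.N r) (D.P s) g = Rel.zero := fun g => by
    by_cases hg : g = T.f
    · rw [hg]; exact rel_zero_of_eq _ _ _ hl hcs.symm (Or.inr hp)
    · exact rel_zero_of_eq _ _ _ hl (by rw [hS0 g hg, hC0 g hg]) (Or.inl (hC0 g hg))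
  rw [hmin r s hall a]; ring

/-! ## The terms of a τ-flag -/

/-- a copy of `Q₀` against a τ-flag: `Q₀ − X' = −a' ℓ_{ζ'}^{(τ)}`, class `0` off `τ`. -/
theorem TopFlag.rel_Q0_flag {τ : Fin 4} (hτf : τ ≠ T.f) {j₀ : Fin D.nP} (hj₀ : T.IsQ0 j₀)
    {r : Fin D.nN} (hr : T.IsFlagOn τ r) :
    rel (D.P j₀) (D.N r) τ = Rel.neg ((D.N r).charge τ) ((D.N r).phase τ) ∧
    ∀ g, g ≠ τ → rel (D.P j₀) (D.N r) g = Rel.zero := by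
  have h := T.isFlagOn_rel_Q0 hτf hr hj₀
  obtain ⟨hl, -, -, h0⟩ := topFlag_Q0 D φ T j₀ hj₀
  exact ⟨rel_uncharged_charged _ _ τ (hl.trans hr.1.symm) (h0 τ hτf) hr.2.2.2.1, fun g hg => rel_zero_symm _ _ g (h.2 g hg)⟩

/-- THE END, a τ-flag `X'` against a copy `Q₀^s`: its term of the row `s` at `(qPair f τ, [τ ↦ y])` is
`ξ̄_{ζ'}(y) · Σ_{ι ∈ R_{a'}} φ_{X' s}(ι) · η'_{X'}(qPair f τ, [f ↦ ē_A, τ ↦ ι])` (evaluation on `τ`, identity on `V_f`). -/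
theorem upper_term_flag_Q0 (η' : Fin D.nN → (Fin 4 → ℕ) → (Fin 4 → ℕ × ℕ) → ℂ) {τ : Fin 4}
    (hτf : τ ≠ T.f) {j₀ : Fin D.nP} (hj₀ : T.IsQ0 j₀) {r : Fin D.nN} (hr : T.IsFlagOn τ r) {s : Fin D.nP}
    (hs : T.IsQ0 s) (y : ℕ × ℕ) :
    ∑ u ∈ idxH2 (D.P j₀) (D.N r), ∑ a ∈ idxH0 (D.N r) (D.P s),
        (if u.1 = qPair T.f τ then coefProd (rel (D.P j₀) (D.N r)) (rel (D.N r) (D.P s)) (qPair T.f τ) u.2 a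
          (Function.update (fun _ => ((0 : ℕ), (0 : ℕ))) τ y) else 0) * φ r s a * η' r u.1 u.2 =
      xiBar ((D.N r).phase τ) y *
        ∑ ι ∈ monIdx ((D.N r).charge τ), φ r s (Function.update (fun _ => ((0 : ℕ), (0 : ℕ))) τ ι) *
          η' r (qPair T.f τ) (Function.update (Function.update (fun _ => ((0 : ℕ), (0 : ℕ))) T.f (0, 0)) τ ι) := by
  obtain ⟨hτU, hU0⟩ := T.rel_Q0_flag hτf hj₀ hr
  obtain ⟨hτS, hS0⟩ := T.isFlagOn_rel_Q0 hτf hr hs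
  rw [term_restrict _ _ _ _ _ (qPair_mem_qDist2 _ _ hτf.symm),
    sum_piFinset_pair _ T.f τ hτf.symm (fun g hgf hgτ => by rw [hU0 g hgτ, qPair_of_ne hgf hgτ, idx_zero_zero]),
    hU0 T.f hτf.symm, qPair_left, idx_zero_one, hτU, qPair_right, idx_neg_one]
  have hc : ∀ y' ι z : ℕ × ℕ, coefProd (rel (D.P j₀) (D.N r)) (rel (D.N r) (D.P s)) (qPair T.f τ)
      (Function.update (Function.update (fun _ => ((0 : ℕ), (0 : ℕ))) T.f y') τ ι)
      (Function.update (fun _ => ((0 : ℕ), (0 : ℕ))) τ z) (Function.update (fun _ => ((0 : ℕ), (0 : ℕ))) τ y) =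
      (if ((0 : ℕ), (0 : ℕ)) = y' then 1 else 0) * ((if z = ι then 1 else 0) * xiBar ((D.N r).phase τ) y) := by
    intro y' ι z
    rw [coefProd_split2 _ _ _ _ _ _ T.f τ hτf.symm (fun g hgf hgτ => by
      rw [hS0 g hgτ, coef_zero_right, update_update_apply_of_ne hgf hgτ, Function.update_of_ne hgτ, if_pos rfl]),
      hU0 T.f hτf.symm, hτU, hS0 T.f hτf.symm, hτS, qPair_left, qPair_right]
    simp only [Function.update_self, Function.update_of_ne hτf.symm, coef_neg_one_pos_self, coef_zero_right]
    split_ifs <;> ring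
  have inner : ∀ y' ι : ℕ × ℕ, ι ∈ monIdx ((D.N r).charge τ) →
      ∑ a ∈ idxH0 (D.N r) (D.P s), coefProd (rel (D.P j₀) (D.N r)) (rel (D.N r) (D.P s))
      (qPair T.f τ) (Function.update (Function.update (fun _ => ((0 : ℕ), (0 : ℕ))) T.f y') τ ι) a
      (Function.update (fun _ => ((0 : ℕ), (0 : ℕ))) τ y) * φ r s a =
      if ((0 : ℕ), (0 : ℕ)) = y' then xiBar ((D.N r).phase τ) y * φ r s (Function.update (fun _ => ((0 : ℕ), (0 : ℕ))) τ ι)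
      else 0 := by
    intro y' ι hι
    unfold idxH0
    rw [sum_piFinset_single _ τ (fun g hg => by rw [hS0 g hg, idx_zero_zero]), hτS, idx_pos_zero,
      Finset.sum_congr rfl (fun z _ => by rw [hc y' ι z]),
      Finset.sum_eq_single_of_mem ι hι (fun z _ hz => by rw [if_neg hz]; ring), if_pos rfl]
    split_ifs <;> ring
  rw [Finset.sum_comm]
  rw [Finset.sum_congr rfl (fun ι hι => Finset.sum_congr rfl (fun y' _ => by rw [inner y' ι hι])), Finset.mul_sum]
  refine Finset.sum_congr rfl fun ι _ => ?_
  simp_rw [ite_mul, zero_mul]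
  rw [Finset.sum_ite_eq]
  simp only [Finset.mem_insert, Finset.mem_singleton, true_or, if_true]
  ring

/-- THE END, a τ-flag against a companion: no section (`h < c` on `f`). -/
theorem upper_term_flag_comp_zero (η' : Fin D.nN → (Fin 4 → ℕ) → (Fin 4 → ℕ × ℕ) → ℂ) {τ : Fin 4}
    {j₀ : Fin D.nP} {r : Fin D.nN} (hr : T.IsFlagOn τ r) {s : Fin D.nP} (hs : T.IsComp s)
    (q : Fin 4 → ℕ) (O : Fin 4 → ℕ × ℕ) :
    ∑ u ∈ idxH2 (D.P j₀) (D.N r), ∑ a ∈ idxH0 (D.N r) (D.P s),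
        (if u.1 = q then coefProd (rel (D.P j₀) (D.N r)) (rel (D.N r) (D.P s)) q u.2 a O else 0) * φ r s a *
          η' r u.1 u.2 = 0 := by
  refine Finset.sum_eq_zero fun u _ => ?_
  have hempty : idxH0 (D.N r) (D.P s) = ∅ := Finset.not_nonempty_iff_eq_empty.mp fun hne => by
    obtain ⟨-, hP0⟩ := (idxH0_nonempty_iff _ _).1 hne
    have h1 := hr.2.2.1; have h2 := hs.2.2.1
    rcases hP0 T.f with h0 | ⟨-, hle⟩ <;> omega
  rw [hempty, Finset.sum_empty]

/-! ## Every other `N r` contributes nothing -/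

/-- THE END, an `N r` that is neither an f-server nor a τ-flag: its terms of the rows `s =` copies ∕ companions vanish —
another layer or charged on `σ` ∕ the fourth factor (no `(f:1, τ:1)` block of `H²(Q₀ − N r)`), too low or cross-phase on `f`
(no section to `P s`), charged on `τ` (then a `≥ 2`-charged `N` of f-charge `> h`, excluded by (F1) `hmax`, or a τ-flag),
pure-f of charge `h` (`Q₀`'s class: `Minimal`; no section to a companion) or `> h` (a server). -/
theorem upper_term_other_zero (hmin : D.Minimal φ) (η' : Fin D.nN → (Fin 4 → ℕ) → (Fin 4 → ℕ × ℕ) → ℂ) {τ : Fin 4}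
    (hτf : τ ≠ T.f) {j₀ : Fin D.nP} (hj₀ : T.IsQ0 j₀) {r : Fin D.nN} (hrS : ¬ T.IsServer r)
    (hrF : ¬ T.IsFlagOn τ r) {s : Fin D.nP} (hs : T.IsQ0 s ∨ T.IsComp s) (O : Fin 4 → ℕ × ℕ) :
    ∑ u ∈ idxH2 (D.P j₀) (D.N r), ∑ a ∈ idxH0 (D.N r) (D.P s),
        (if u.1 = qPair T.f τ then coefProd (rel (D.P j₀) (D.N r)) (rel (D.N r) (D.P s)) (qPair T.f τ) u.2 a O
          else 0) * φ r s a * η' r u.1 u.2 = 0 := by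
  obtain ⟨hQl, hQf, hQph, hQ0⟩ := topFlag_Q0 D φ T j₀ hj₀
  -- no section `P s → N r` at all?
  by_cases hne : (idxH0 (D.N r) (D.P s)).Nonempty
  swap
  · rw [Finset.not_nonempty_iff_eq_empty.mp hne]; simp
  obtain ⟨hl, hph, hge⟩ := T.layer_phase_of_section hs hne
  -- a charged factor `g ∉ {f, τ}` of `N r` empties the block `(f:1, τ:1)` of `H²(Q₀ − N r)` (`q_g = 0` under a negative letter)
  by_cases hg : ∃ g, g ≠ T.f ∧ g ≠ τ ∧ (D.N r).charge g ≠ 0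
  · obtain ⟨g, hgf, hgτ, hgc⟩ := hg
    refine Finset.sum_eq_zero fun u hu => ?_
    by_cases hu1 : u.1 = qPair T.f τ
    swap
    · simp [hu1]
    exfalso
    have := ((mem_idxH2_iff _ _ u).1 hu).2 g
    rw [hu1, qPair_of_ne hgf hgτ, rel_uncharged_charged _ _ g (hQl.trans hl.symm) (hQ0 g hgf) hgc, idx_neg_zero] at this
    simp at this
  push Not at hg
  -- so `N r` is uncharged off `{f, τ}`; on `f` it carries `ζ` with charge `≥ h`
  by_cases hτc : (D.N r).charge τ = 0
  · -- pure-f: charge `h` is `Q₀`'s class (`Minimal` ∕ no section to a companion), charge `> h` is a server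
    rcases hge.lt_or_eq with hlt | heq
    · exact absurd ⟨hl, hph, hlt, fun g hgf => by
        by_cases hgτ : g = τ
        · rw [hgτ]; exact hτc
        · exact hg g hgf hgτ⟩ hrS
    · rcases hs with hs | hs
      · have hall : ∀ g, rel (D.N r) (D.P s) g = Rel.zero := fun g => by
          obtain ⟨hl', hf', hph', h0'⟩ := topFlag_Q0 D φ T s hs
          by_cases hgf : g = T.f
          · rw [hgf]; exact rel_zero_of_eq _ _ _ (hl.trans hl'.symm) (heq.symm.trans hf'.symm) (Or.inr (hph.trans hph'.symm))
          by_cases hgτ : g = τ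
          · rw [hgτ]; exact rel_zero_of_eq _ _ _ (hl.trans hl'.symm) (by rw [hτc, h0' τ hτf]) (Or.inl (h0' τ hτf))
          · exact rel_zero_of_eq _ _ _ (hl.trans hl'.symm) (by rw [hg g hgf hgτ, h0' g hgf]) (Or.inl (h0' g hgf))
        refine Finset.sum_eq_zero fun u _ => Finset.sum_eq_zero fun a _ => ?_
        rw [hmin r s hall a]; ring
      · exfalso
        obtain ⟨-, hP0⟩ := (idxH0_nonempty_iff _ _).1 hne
        have h2 := hs.2.2.1
        rcases hP0 T.f with h0 | ⟨-, hle⟩ <;> omega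
  · -- charged on `τ` and on `f`: `≥ 2`-charged, so f-charge `≤ h` by (F1), hence a τ-flag
    have h2 := two_le_nCharged _ τ T.f hτf hτc (by have := T.flag_f; omega)
    have hle := T.hmax (D.N r) (D.N_mem r) h2
    exact absurd ⟨hl, hph, le_antisymm hle hge, hτc, fun g hgτ hgf => hg g hgf hgτ⟩ hrF

end EndTerms

end Summit.Ventures.HSemireg.Pad4FirstOrder
end
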